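/-
Copyright (c) 2026 the pub-hodgecm-mathlib formalisation cell (harness21).  Prover seat hodgecm-mathlib-K2E1-p14 (g2), Track B «K2-LIT» ENGINE E1, h413 =
`stmt-HodgeConjecture-24833`, route `HCCMUnconditional`, 5Res ROADCARD §3′ D4′c (SD) AT M1 — THE SQUARE-ROOT EDITION of ★ p860865 §1 ∕ ★ p861211 (K2E4-p23's RUNG-1 SD package
needs the explicit residue coordinate `r_i c = √C • T_c Ψ̂_i(−c)` that K2E1-p11's ★ `hU_selfDual_cm_two` consumes, ★ p860798's currency).
-/
import Summits.HodgeConjecture.HodgeConjecture.Theorems.K2E1ChiSectionPlancherelSelfDualM1CMTwoLetterFree   -- ★ p861211 (this seat): brings ★ p861041, ★ p861074, ★ p860947, ★ p860865, ★ p860788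
import Summits.HodgeConjecture.HodgeConjecture.Theorems.K2E1ChiSectionPlancherelSelfDualCMTwoExplicit      -- ★ p860798 (K2E4-p10): `exists_linearIsometry_selfDual_of_pureTensor_letters_sqrt`
import HarnessLib

/-!
# D4′c (SD) at M1, SQUARE-ROOT EDITION — `K2E1ChiSectionPlancherelSelfDualM1CMTwoSqrt`: the letter-free rank-one self-dual block isometry WITH THE EXPLICIT RESIDUE COORDINATE
# `r′_i c = √C • T_c Ψ̂_i(−c)`, `T_c = (ρ_c•id)^{1∕2}` (★ p860798's `T`-currency, consumed by ★ `hU_selfDual_cm_two`)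

Track B ∕ K2-LIT, crux h413 = `stmt-HodgeConjecture-24833`, route of record `HCCMUnconditional`; cell `hodgecm-mathlib`, squad K2, ENGINE E1.  THEOREMS ONLY (no `def`, no `instance`,
no `notation`, no named-fact hypothesis, no `sorry`; default heartbeats); lane `--supports stmt-HodgeConjecture-24833 --as helper` (count-neutral).  NO ★ STATEMENT IS EDITED: these are
new theorems (editions `…_sqrt`) next to ★ p860865 §1, ★ p861211 §2∕§3.

THE MATHEMATICS ([MoeglinWaldspurger1995, II.2.4, IV.3.12]; [Langlands1976, §7]).  ★ p861211 exports the residue block of the Plancherel isometry `U (Σ_a y_{i,a}) = (r′_i, √(C∕2π)•w_i)` only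
through its Gram `⟪r′_i, r′_j⟫ = C·Σ_c ρ_c ⟪Ψ̂_i(−c), Ψ̂_j(−c)⟫`; the RUNG-1 consumer (K2E4-p23's SD-block package, via K2E1-p11's ★ `hU_selfDual_cm_two`) needs the WITNESS: the positive
square roots `T_c` of the residue operators `R_c = ρ_c•id` and `r′_i c = √C • T_c Ψ̂_i(−c)` (★ K2E4-p10 `exists_linearIsometry_selfDual_of_pureTensor_letters_sqrt`).  This file re-threads
the rank-one chain through that edition: §1 generic scalar letters (= ★ p860865 §1 ∧ `T`-clauses), §2 on the pinned package clauses with every (SD) letter discharged (= ★ p861211 §2 ∧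
`T`-clauses: `hs∕S` ★ LetterFree, residues ★ p860849 ∘ ★ p861041 §1, (FE) ★ σ2, (conj) ★ p860445, axis ★ p860080, `hB` ★ p861074, `hSD` ★ p860947), §3 HEAD structural binders only
(= ★ p861211 §3 ∧ `T`-clauses).
* §1 `exists_linearIsometry_selfDual_of_scalar_letters_sqrt`.  * §2 `exists_linearIsometry_chiSection_selfDual_m1_rankOne_sqrt_of_package`.
* §3 HEAD **`exists_linearIsometry_chiSection_selfDual_m1_letterFree_sqrt_cm_two`** — `∃ s P C S ρ T r′ w U`: ★ p861211's clauses ∧ `T_c(T_c u) = ρ_c•u` ∧ `T_c` symmetric ∧ positive ∧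
  **`r′_i c = √C • T_c (Σ_a f̃_{i,a}(−c)•ṽ_a)`** — with `vA a := ṽ_a`, `M z := s z • id` these are ★ `hU_selfDual_cm_two`'s `(T, r, w, Uiso, hr_apply, hw, hU)`.
HONEST LABEL: HC_CM is proved only modulo the 7 printed citations (2 remaining named inputs: hLiu418 = `stmt-HodgeConjecture-24832`, h413 = `stmt-HodgeConjecture-24833`) until rung 0
closes; this file asserts no named fact, closes no socket; count-neutral; NO letters beyond the structural data of the M1 datum.

## References
* [MoeglinWaldspurger1995] C. Mœglin, J.-L. Waldspurger, *Spectral decomposition and Eisenstein series* (1995), II.2.4, IV.3.12.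
* [Langlands1976] R. P. Langlands, *On the Functional Equations Satisfied by Eisenstein Series*, LNM 544 (1976), §7.
-/

set_option autoImplicit false
set_option linter.dupNamespace false  -- the mandated namespace repeats the summit's segment (`HodgeConjecture.HodgeConjecture`)

noncomputable section

open MeasureTheory MeasureTheory.Measure Set NumberField IsDedekindDomain Filter Topology Complex
open scoped Real NNReal ENNReal ComplexConjugate InnerProductSpace BigOperators
open Literature.MeasureTheory.Group Literature.NumberTheory
open Literature.NumberTheory.Automorphic Literature.NumberTheory.Automorphic.UnitaryGroup AdelicGroupData
open Literature.NumberTheory.GaloisRepresentations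
open Summit.HodgeConjecture.HodgeConjecture.Cruxes.H413.K2E1BorelEisensteinU
open Summit.HodgeConjecture.HodgeConjecture.Cruxes.H413.K2E1BLBorelSpacesU2Defs
open Summit.HodgeConjecture.HodgeConjecture.Cruxes.H413.K2E1BLBorelOperatorsU2Defs
open Summit.HodgeConjecture.HodgeConjecture.Cruxes.H413.K2E1CharacterEisensteinU2Defs
open Summit.HodgeConjecture.HodgeConjecture.Cruxes.H413.K2E1ChiSectionSpaceU2Defs
open Summit.HodgeConjecture.HodgeConjecture.Cruxes.H413.K2E1ChiSectionPlancherelSelfDualCMTwoExplicit (exists_linearIsometry_selfDual_of_pureTensor_letters_sqrt)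
open Summit.HodgeConjecture.HodgeConjecture.Cruxes.H413.K2E1ChiSectionPlancherelSelfDualCMTwo (finiteDimensional_span_range)
open Summit.HodgeConjecture.HodgeConjecture.Cruxes.H413.K2E1ChiSectionPlancherelSelfDualM1CMTwoComplete (tendsto_sub_mul_of_rankOne_pairing div_real_im_re)
open Summit.HodgeConjecture.HodgeConjecture.Cruxes.H413.K2E1ChiSectionPlancherelSelfDualM1CMTwoLetterFree (tube_formula_smul)
open Summit.HodgeConjecture.HodgeConjecture.Cruxes.H413.K2E1ChiScatteringStripBoundOfPackageM1CMTwo (hB_of_package_m1_cm_two)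
open Summit.HodgeConjecture.HodgeConjecture.Cruxes.H413.K2E1ChiSectionPlancherelSDGramLetterM1CMTwo (hSD_m1_cm_two)
open Summit.HodgeConjecture.HodgeConjecture.Cruxes.H413.K2E1ChiScatteringRealPolesM1CMTwoComplete (chi_scattering_real_poles_m1_complete_cm_two)
open Summit.HodgeConjecture.HodgeConjecture.Cruxes.H413.K2E1ChiScatteringRealPolesM1CMTwoLetterFree (chi_scattering_hs_of_scalarPackage_m1_cm_two)
open Summit.HodgeConjecture.HodgeConjecture.Cruxes.H413.K2E1ChiScatteringRealPolesM1CMTwoFinal (ne_zero_of_coeFn_ae_eq)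
open Summit.HodgeConjecture.HodgeConjecture.Cruxes.H413.K2E1ChiScatteringFunctionalEquationM1CMTwo (chi_scattering_fe_m1_cm_two)
open Summit.HodgeConjecture.HodgeConjecture.Cruxes.H413.K2E1ChiMaassSelbergDecayLetterM1CMTwo (hdec_maximalLevel_cm_two)
open Summit.HodgeConjecture.HodgeConjecture.Cruxes.H413.K2E1ChiMaassSelbergResidueM1CMTwo (chi_maassSelberg_residue_m1_cm_two)
open Summit.HodgeConjecture.HodgeConjecture.Cruxes.H413.K2E1ChiScatteringConjSymmetryM1CMTwo (chi_scattering_conj_symm_m1_cm_two exists_galTwist_cm)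
open Summit.HodgeConjecture.HodgeConjecture.Cruxes.H413.K2E1ChiUnitaryAxisContinuationCMTwo (continuous_axis_of_fe_of_conj)
open Summit.HodgeConjecture.HodgeConjecture.Cruxes.H413.K2E1MaassSelbergSphericalBracketsCMThree (idelicBracket_pos)
open Summit.HodgeConjecture.HodgeConjecture.Cruxes.H413.K2E1PlancherelIsometryOfForm (mem_topologicalClosure_span)

namespace Summit.HodgeConjecture.HodgeConjecture.Cruxes.H413.K2E1ChiSectionPlancherelSelfDualM1CMTwoSqrt

/-! ## §1 Generic: the rank-one isometry from scalar letters, square-root edition -/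

section Generic

variable {V : Type*} [NormedAddCommGroup V] [InnerProductSpace ℂ V] {H : Type*} [NormedAddCommGroup H] [InnerProductSpace ℂ H] {ι α : Type*} [Fintype α]

/-- **THE SELF-DUAL BLOCK ISOMETRY FROM SCALAR LETTERS (rank one), SQUARE-ROOT EDITION** (= ★ p860865 §1 `exists_linearIsometry_selfDual_of_scalar_letters` ∧ ★ p860798's
clauses): with `M(z) = s(z)•id`, `R_c = ρ_c•id` the eight vector letters follow from the scalar ones, and ★ `exists_linearIsometry_selfDual_of_pureTensor_letters_sqrt` gives `T_c` (the
positive square root: `T_c(T_c u) = ρ_c•u`, symmetric, `0 ≤ re ⟪u, T_c u⟫`), **`r_i c = √C • T_c Ψ̂_i(−c)`**, the Gram, the axis model and `U (Σ_a y_{i,a}) = (r_i, √(C∕2π)•w_i)`.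
[cite: MoeglinWaldspurger1995, II.2.4 and IV.3.12] [cite: Langlands1976, §7] -/
theorem exists_linearIsometry_selfDual_of_scalar_letters_sqrt [FiniteDimensional ℂ V]
    (y : ι → α → H) {f : ι → α → ℝ → ℂ}
    (hf : ∀ i a, ContDiff ℝ 2 (f i a)) (hfs : ∀ i a, HasCompactSupport (f i a)) (hf0 : ∀ i a, tsupport (f i a) ⊆ Ioi 0)
    (v : α → V) (s : ℂ → ℂ) {σ₀ : ℝ} (hσ₀ : 1 / 2 < σ₀)
    {U : Set ℂ} (hUo : IsOpen U) (hUs : {z : ℂ | 1 / 2 ≤ z.re ∧ z.re ≤ σ₀} ⊆ U) (S : Finset ℝ) (hS : ∀ c ∈ S, 1 / 2 < c ∧ c < σ₀)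
    (hs : DifferentiableOn ℂ s (U \ ((S.image fun c : ℝ => (c : ℂ)) : Set ℂ)))
    (ρ : ℝ → ℂ) (hr : ∀ c ∈ S, Tendsto (fun z : ℂ => (z - c) * s z) (𝓝[≠] (c : ℂ)) (𝓝 (ρ c)))
    (hρim : ∀ c ∈ S, (ρ c).im = 0) (hρre : ∀ c ∈ S, 0 ≤ (ρ c).re)
    {B : ℝ} (hB : ∀ z : ℂ, 1 / 2 < z.re → z.re ≤ σ₀ → 1 ≤ |z.im| → ‖s z‖ ≤ B)
    {P : Set ℂ} (hPcd : ∀ z₀ : ℂ, ∀ᶠ w in 𝓝[≠] z₀, w ∉ P)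
    (hFE : ∀ z : ℂ, z ∉ P → 1 - z ∉ P → s z * s (1 - z) = 1) (hconj : ∀ z : ℂ, z ∉ P → conj z ∉ P → s (conj z) = conj (s z))
    (hcont : Continuous fun t : ℝ => s ((((1 / 2 : ℝ)) : ℂ) + t * I))
    {C : ℝ} (hC : 0 ≤ C)
    (hSD : ∀ i j a b, ⟪y i b, y j a⟫_ℂ = (C : ℂ) * ((((2 * π)⁻¹ : ℝ) : ℂ) * ∫ t : ℝ, mellin (f j a) (-((σ₀ : ℂ) + t * I)) *
      (⟪v b, v a⟫_ℂ * conj (mellin (f i b) (-(1 - conj ((σ₀ : ℂ) + t * I)))) + s ((σ₀ : ℂ) + t * I) * ⟪v b, v a⟫_ℂ * conj (mellin (f i b) (-conj ((σ₀ : ℂ) + t * I)))))) :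
    ∃ (T : ↥S → V →L[ℂ] V) (r : ι → PiLp 2 (fun _ : ↥S => V)) (w : ι → Lp V 2 ((volume : Measure ℝ).restrict (Ioi 0)))
      (Uiso : (Submodule.span ℂ (Set.range fun i => ∑ a, y i a)).topologicalClosure →ₗᵢ[ℂ] WithLp 2 (PiLp 2 (fun _ : ↥S => V) × Lp V 2 ((volume : Measure ℝ).restrict (Ioi 0)))),
      (∀ (c : ↥S) (u : V), T c (T c u) = ρ (c : ℝ) • u) ∧ (∀ (c : ↥S) (u u' : V), ⟪u, T c u'⟫_ℂ = ⟪T c u, u'⟫_ℂ) ∧ (∀ (c : ↥S) (u : V), 0 ≤ RCLike.re ⟪u, T c u⟫_ℂ) ∧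
      (∀ i (c : ↥S), r i c = ((Real.sqrt C : ℝ) : ℂ) • T c (∑ a, mellin (f i a) (-((c : ℝ) : ℂ)) • v a)) ∧
      (∀ i j, ⟪r i, r j⟫_ℂ = (C : ℂ) * ∑ c ∈ S, ⟪∑ b, mellin (f i b) (-(c : ℂ)) • v b, ρ c • ∑ a, mellin (f j a) (-(c : ℂ)) • v a⟫_ℂ) ∧
      (∀ i, (w i : ℝ → V) =ᵐ[(volume : Measure ℝ).restrict (Ioi 0)] fun t => (∑ a, mellin (f i a) (-((((1 / 2 : ℝ)) : ℂ) + t * I)) • v a) +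
        s ((((1 / 2 : ℝ)) : ℂ) + ((-t : ℝ) : ℂ) * I) • ∑ a, mellin (f i a) (-((((1 / 2 : ℝ)) : ℂ) + ((-t : ℝ) : ℂ) * I)) • v a) ∧
      (∀ i, Uiso ⟨∑ a, y i a, mem_topologicalClosure_span (fun i => ∑ a, y i a) i⟩ = WithLp.toLp 2 (r i, ((Real.sqrt (C * (2 * π)⁻¹) : ℝ) : ℂ) • w i)) := by
  -- the forced rank-one operator data (kept abstract through their defining equations)
  obtain ⟨M, hM⟩ : ∃ M : ℂ → V →ₗ[ℂ] V, ∀ z u, M z u = s z • u := ⟨fun z => s z • LinearMap.id, fun _ _ => rfl⟩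
  obtain ⟨R, hR⟩ : ∃ R : ℝ → V →ₗ[ℂ] V, ∀ c u, R c u = ρ c • u := ⟨fun c => ρ c • LinearMap.id, fun _ _ => rfl⟩
  -- the strip bound is nonnegative (test point `σ₀ + i`)
  have hB0 : 0 ≤ B := (norm_nonneg _).trans (hB ((σ₀ : ℂ) + I) (by simp; linarith) (by simp) (by simp))
  -- the eight vector letters of ★ part 5 §2
  have hs' : ∀ a b, DifferentiableOn ℂ (fun z : ℂ => ⟪v b, M z (v a)⟫_ℂ) (U \ ((S.image fun c : ℝ => (c : ℂ)) : Set ℂ)) := fun a b => by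
    simp only [hM, inner_smul_right]
    exact hs.mul (differentiableOn_const _)
  have hr' : ∀ a b, ∀ c ∈ S, Tendsto (fun z : ℂ => (z - c) * ⟪v b, M z (v a)⟫_ℂ) (𝓝[≠] (c : ℂ)) (𝓝 ⟪v b, R c (v a)⟫_ℂ) := fun a b c hc => by
    simp only [hM, hR, inner_smul_right, ← mul_assoc]
    exact (hr c hc).mul_const _
  have hB' : ∀ a b, ∀ z : ℂ, 1 / 2 < z.re → z.re ≤ σ₀ → 1 ≤ |z.im| → ‖⟪v b, M z (v a)⟫_ℂ‖ ≤ B * ∑ a', ∑ b', ‖⟪v b', v a'⟫_ℂ‖ := fun a b z h1 h2 h3 => by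
    rw [hM, inner_smul_right, norm_mul]
    have hab : ‖⟪v b, v a⟫_ℂ‖ ≤ ∑ a', ∑ b', ‖⟪v b', v a'⟫_ℂ‖ :=
      (Finset.single_le_sum (f := fun b' => ‖⟪v b', v a⟫_ℂ‖) (fun _ _ => norm_nonneg _) (Finset.mem_univ b)).trans
        (Finset.single_le_sum (f := fun a' => ∑ b', ‖⟪v b', v a'⟫_ℂ‖) (fun _ _ => Finset.sum_nonneg fun _ _ => norm_nonneg _) (Finset.mem_univ a))
    exact mul_le_mul (hB z h1 h2 h3) hab (norm_nonneg _) hB0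
  have hRsymm : ∀ c ∈ S, ∀ u u' : V, ⟪u, R c u'⟫_ℂ = ⟪R c u, u'⟫_ℂ := fun c hc u u' => by
    rw [hR, hR, inner_smul_right, inner_smul_left, Complex.conj_eq_iff_im.2 (hρim c hc)]
  have hRpos : ∀ c ∈ S, ∀ u : V, 0 ≤ RCLike.re ⟪u, R c u⟫_ℂ := fun c hc u => by
    have h0 : 0 ≤ RCLike.re ⟪u, u⟫_ℂ := inner_self_nonneg
    rw [RCLike.re_to_complex] at h0
    rw [hR, inner_smul_right, RCLike.re_to_complex, Complex.mul_re, hρim c hc, zero_mul, sub_zero]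
    exact mul_nonneg (hρre c hc) h0
  have hFE' : ∀ z : ℂ, z ∉ P → 1 - z ∉ P → ∀ u : V, M (1 - z) (M z u) = u := fun z hz hz' u => by
    rw [hM, hM, smul_smul, mul_comm, hFE z hz hz', one_smul]
  have hadj' : ∀ z : ℂ, z ∉ P → conj z ∉ P → ∀ u u' : V, ⟪u, M z u'⟫_ℂ = ⟪M (conj z) u, u'⟫_ℂ := fun z hz hz' u u' => by
    rw [hM, hM, inner_smul_right, inner_smul_left, hconj z hz hz', Complex.conj_conj]
  have hcont' : ∀ u : V, Continuous fun t : ℝ => M ((((1 / 2 : ℝ)) : ℂ) + t * I) u := fun u => by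
    simp only [hM]
    exact hcont.smul continuous_const
  have hSD' : ∀ i j a b, ⟪y i b, y j a⟫_ℂ = (C : ℂ) * ((((2 * π)⁻¹ : ℝ) : ℂ) * ∫ t : ℝ, mellin (f j a) (-((σ₀ : ℂ) + t * I)) *
      (⟪v b, v a⟫_ℂ * conj (mellin (f i b) (-(1 - conj ((σ₀ : ℂ) + t * I)))) + ⟪v b, M ((σ₀ : ℂ) + t * I) (v a)⟫_ℂ * conj (mellin (f i b) (-conj ((σ₀ : ℂ) + t * I))))) := by
    intro i j a b
    simp only [hM, inner_smul_right]
    exact hSD i j a b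
  obtain ⟨T, r, w, Uiso, hT1, hT2, hT3, hra, h1, h2, h3⟩ := exists_linearIsometry_selfDual_of_pureTensor_letters_sqrt y hf hfs hf0 v M hσ₀ hUo hUs S hS hs' R hr' hB' hRsymm hRpos
    hPcd hFE' hadj' hcont' hC hSD'
  refine ⟨T, r, w, Uiso, fun c u => (hT1 c u).trans (hR _ _), hT2, hT3, hra, fun i j => ?_, fun i => ?_, h3⟩
  · simpa only [hR] using h1 i j
  · simpa only [hM] using h2 i

end Generic

/-! ## §2 The rank-one block on the package clauses, square-root edition (every (SD) letter discharged) -/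

section CM

variable (L : Type) [Field L] [NumberField L] [IsCMField L]
variable [MeasurableSpace (quasiSplit (↥(maximalRealSubfield L)) L (IsCMField.complexConj L) 2).Adelic] [BorelSpace (quasiSplit (↥(maximalRealSubfield L)) L (IsCMField.complexConj L) 2).Adelic]
variable [MeasurableSpace (AdeleRing (𝓞 L) L)ˣ] [BorelSpace (AdeleRing (𝓞 L) L)ˣ]

/-- **THE RANK-ONE SELF-DUAL BLOCK AT M1 ON THE PACKAGE CLAUSES, SQUARE-ROOT EDITION** (= ★ p861211 §2 ∧ the `T`-clauses).  Binders: ★ p861041's package block; the rank-one pure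
tensors (`c_a ≠ 0`, `v_a =ᵐ (c_a•φ)|_{K_max}`, `f_{i,a}`, `y_{i,a} =ᵐ θ_{f_{i,a}, c_a•φ}`); `σ₀ > 1`.  Every (SD) letter discharged inside (`hs∕S` ★ LetterFree ∘ ★ hdec ∘ ★ σ2; residues ★
p860849 ∘ rank-one rescaling; (conj) ★ p860445; axis ★ p860080; `hB` ★ p861074; `hSD` ★ p860947), then §1 at `V := W = span {v_a}`. [cite: MoeglinWaldspurger1995, II.2.4, IV.1.11 and IV.3.12]
[cite: Langlands1976, §7] -/
theorem exists_linearIsometry_chiSection_selfDual_m1_rankOne_sqrt_of_package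
    (μ : Measure (quasiSplit (↥(maximalRealSubfield L)) L (IsCMField.complexConj L) 2).automorphicQuotient) [(quasiSplit (↥(maximalRealSubfield L)) L (IsCMField.complexConj L) 2).IsAutomorphicMeasure μ]
    (νG : Measure (quasiSplit (↥(maximalRealSubfield L)) L (IsCMField.complexConj L) 2).Adelic) [νG.IsHaarMeasure] [νG.IsInvInvariant] [SFinite νG]
    (μK : Measure ↥((standardMaximalCompactGL 2 L).comap (adelicVal (↥(maximalRealSubfield L)) L (IsCMField.complexConj L) 2 ((StdForm.antidiagonal 2).over L)) : Subgroup (quasiSplit (↥(maximalRealSubfield L)) L (IsCMField.complexConj L) 2).Adelic)) [μK.IsHaarMeasure]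
    (νI : Measure (AdeleRing (𝓞 L) L)ˣ) [νI.IsHaarMeasure]
    {𝓕I : Set (AdeleRing (𝓞 L) L)ˣ} (h𝓕I : IsIdeleClassDomain L 𝓕I)
    (ν : Measure ↥(adelicUnipotent (↥(maximalRealSubfield L)) L (IsCMField.complexConj L) 2)) [ν.IsHaarMeasure] [ν.IsMulRightInvariant] [ν.IsInvInvariant]
    {𝓕 : Set ↥(adelicUnipotent (↥(maximalRealSubfield L)) L (IsCMField.complexConj L) 2)} (h𝓕N : IsFundamentalDomain ↥(rationalUnipotent (↥(maximalRealSubfield L)) L (IsCMField.complexConj L) 2) 𝓕 ν) (h𝓕1 : ν 𝓕 = 1)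
    (h𝓕c : IsCompact (closure 𝓕))
    {β : (quasiSplit (↥(maximalRealSubfield L)) L (IsCMField.complexConj L) 2).Adelic → ℝ≥0∞} (hβ : IsCoveringWeight ↥((arithmeticBorel (↥(maximalRealSubfield L)) L (IsCMField.complexConj L) 2).map (quasiSplit (↥(maximalRealSubfield L)) L (IsCMField.complexConj L) 2).arithmeticSubgroup.subtype) β)
    {μZ : Measure (borelQuotient (↥(maximalRealSubfield L)) L (IsCMField.complexConj L) 2)} [SFinite μZ]
    (hμZ : ∀ f : borelQuotient (↥(maximalRealSubfield L)) L (IsCMField.complexConj L) 2 → ℝ≥0∞, Measurable f → ∫⁻ z, f z ∂μZ = ∫⁻ g, β g * f (toBorelQuotient (↥(maximalRealSubfield L)) L (IsCMField.complexConj L) 2 g) ∂νG)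
    {χ : HeckeCharacter L} (hχ : χ.IsUnitary) (hρ : ∀ r : ℝ≥0ˣ, χ (posRealIdele L r) = 1) (hsd : reflectChar (IsCMField.complexConj L) χ = χ)
    {φ : (quasiSplit (↥(maximalRealSubfield L)) L (IsCMField.complexConj L) 2).Adelic → ℂ} (hφV : φ ∈ chiSectionSpace χ ((standardMaximalCompactGL 2 L).comap (adelicVal (↥(maximalRealSubfield L)) L (IsCMField.complexConj L) 2 ((StdForm.antidiagonal 2).over L)) : Subgroup (quasiSplit (↥(maximalRealSubfield L)) L (IsCMField.complexConj L) 2).Adelic) (fun _ => 1)) (hφc : Continuous φ) {Mφ : ℝ} (hφM : ∀ x, ‖φ x‖ ≤ Mφ)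
    (hφinf : ∀ a : arch (↥(maximalRealSubfield L)) L (IsCMField.complexConj L) 2 ((StdForm.antidiagonal 2).over L), φ (archToAdelic (↥(maximalRealSubfield L)) L (IsCMField.complexConj L) 2 _ a) = φ 1)
    (hφ1 : φ 1 ≠ 0) (hφ1r : conj (φ 1) = φ 1)
    {q qc : Unit → ℂ → ℂ} {Ec : ℂ → (quasiSplit (↥(maximalRealSubfield L)) L (IsCMField.complexConj L) 2).Adelic → ℂ} {P : Set ℂ}
    (hqφ : ∀ z : ℂ, 1 < z.re → (∑ j, q j z • φ) = ((((ν 𝓕).toReal⁻¹ : ℝ)) : ℂ) • (fun g : (quasiSplit (↥(maximalRealSubfield L)) L (IsCMField.complexConj L) 2).Adelic => (∫ v : ↥(adelicUnipotent (↥(maximalRealSubfield L)) L (IsCMField.complexConj L) 2), flatSectionU φ z ((quasiSplit (↥(maximalRealSubfield L)) L (IsCMField.complexConj L) 2).toAdelic (weylLongU ((IsCMField.complexConj L : L ≃ₐ[↥(maximalRealSubfield L)] L) : L →+* L) (rfl : (StdForm.antidiagonal 2).over L = (StdForm.antidiagonal 2).over L)) * ((v : (quasiSplit (↥(maximalRealSubfield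 L)) L (IsCMField.complexConj L) 2).Adelic) * g)) ∂ν) * (((borelHeight g : ℝ) : ℂ) ^ (z - 1))))
    (hqNF : ∀ j, MeromorphicNFOn (qc j) univ) (hE1 : ∀ z : ℂ, 1 < z.re → Ec z = eisensteinSeriesU (flatSectionU φ z)) (hqcq : ∀ j (z : ℂ), 1 < z.re → qc j z = q j z)
    (hPc : IsClosed P) (hPcd : ∀ z₀ : ℂ, ∀ᶠ s in 𝓝[≠] z₀, s ∉ P) (hPre : ∀ z ∈ P, z.re ≤ 1) (hqa : ∀ j (z : ℂ), z ∉ P → AnalyticAt ℂ (qc j) z)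
    (U : ℕ → Set ℂ) (hUo : ∀ n, IsOpen (U n)) (hUcod : ∀ n : ℕ, ∀ z₀ ∈ Metric.ball (0 : ℂ) (n + 2), ∀ᶠ s in 𝓝[≠] z₀, s ∈ U n)
    (T₀ : ℕ → ℝ≥0) (hT₀ : ∀ n, 1 ≤ T₀ n) (Fam : ℕ → ℂ → Lp ℂ 2 μ) (hFd : ∀ n, DifferentiableOn ℂ (Fam n) (U n \ P))
    (hFam : ∀ n, ∀ z ∈ U n \ P, ((Fam n z : Lp ℂ 2 μ) : (quasiSplit (↥(maximalRealSubfield L)) L (IsCMField.complexConj L) 2).automorphicQuotient → ℂ) =ᵐ[μ] (quasiSplit (↥(maximalRealSubfield L)) L (IsCMField.complexConj L) 2).quotFun (truncation ν 𝓕 (T₀ n) (Ec z)))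
    (hs_tube : ∀ z : ℂ, 1 < z.re → qc default z = (((ν 𝓕).toReal⁻¹ : ℝ) : ℂ) * ((φ 1)⁻¹ * ∫ v : ↥(adelicUnipotent (↥(maximalRealSubfield L)) L (IsCMField.complexConj L) 2), flatSectionU φ z
        ((quasiSplit (↥(maximalRealSubfield L)) L (IsCMField.complexConj L) 2).toAdelic (weylLongU (IsCMField.complexConj L : L →+* L)
          (rfl : (StdForm.antidiagonal 2).over L = (StdForm.antidiagonal 2).over L)) * ((v : (quasiSplit (↥(maximalRealSubfield L)) L (IsCMField.complexConj L) 2).Adelic) * 1)) ∂ν))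
    -- the rank-one pure tensors `f_{i,a} ⊗ (c_a•φ)`: scalars, `L²(K_max)`-representatives, test functions, classes
    {ι α : Type*} [Fintype α] (c : α → ℂ) (hc : ∀ a, c a ≠ 0)
    (v : α → Lp ℂ 2 μK) (hv : ∀ a, ((v a : Lp ℂ 2 μK) : ↥((standardMaximalCompactGL 2 L).comap (adelicVal (↥(maximalRealSubfield L)) L (IsCMField.complexConj L) 2 ((StdForm.antidiagonal 2).over L)) : Subgroup (quasiSplit (↥(maximalRealSubfield L)) L (IsCMField.complexConj L) 2).Adelic) → ℂ) =ᵐ[μK]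
      fun k => (c a • φ) (k : (quasiSplit (↥(maximalRealSubfield L)) L (IsCMField.complexConj L) 2).Adelic))
    {f : ι → α → ℝ → ℂ} (hf : ∀ i a, ContDiff ℝ 2 (f i a)) (hfs : ∀ i a, HasCompactSupport (f i a)) (hf0 : ∀ i a, tsupport (f i a) ⊆ Ioi 0)
    (y : ι → α → Lp ℂ 2 μ) (hy : ∀ i a, ((y i a : Lp ℂ 2 μ) : (quasiSplit (↥(maximalRealSubfield L)) L (IsCMField.complexConj L) 2).automorphicQuotient → ℂ) =ᵐ[μ]
      (quasiSplit (↥(maximalRealSubfield L)) L (IsCMField.complexConj L) 2).quotFun (eisensteinSeriesU (fun g : (quasiSplit (↥(maximalRealSubfield L)) L (IsCMField.complexConj L) 2).Adelic => f i a (borelHeight g : ℝ) * (c a • φ) g)))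
    {σ₀ : ℝ} (hσ₀ : 1 < σ₀) :
    ∃ (C : ℝ) (S : Finset ℝ) (ρ : ℝ → ℂ) (T : ↥S → ↥(Submodule.span ℂ (Set.range v)) →L[ℂ] ↥(Submodule.span ℂ (Set.range v))) (r' : ι → PiLp 2 (fun _ : ↥S => ↥(Submodule.span ℂ (Set.range v))))
      (w : ι → Lp ↥(Submodule.span ℂ (Set.range v)) 2 ((volume : Measure ℝ).restrict (Ioi 0)))
      (Uiso : (Submodule.span ℂ (Set.range fun i => ∑ a, y i a)).topologicalClosure →ₗᵢ[ℂ]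
        WithLp 2 (PiLp 2 (fun _ : ↥S => ↥(Submodule.span ℂ (Set.range v))) × Lp ↥(Submodule.span ℂ (Set.range v)) 2 ((volume : Measure ℝ).restrict (Ioi 0)))),
      0 < C ∧
      (∀ c ∈ S, ¬ AnalyticAt ℂ (qc default) (c : ℂ) ∧ 1 / 2 < c ∧ c < σ₀) ∧
      (∀ c ∈ S, Tendsto (fun z : ℂ => (z - c) * qc default z) (𝓝[≠] (c : ℂ)) (𝓝 (ρ c)) ∧ (ρ c).im = 0 ∧ 0 ≤ (ρ c).re) ∧
      (∀ (c : ↥S) (u : ↥(Submodule.span ℂ (Set.range v))), T c (T c u) = ρ (c : ℝ) • u) ∧ (∀ (c : ↥S) (u u' : ↥(Submodule.span ℂ (Set.range v))), ⟪u, T c u'⟫_ℂ = ⟪T c u, u'⟫_ℂ) ∧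
      (∀ (c : ↥S) (u : ↥(Submodule.span ℂ (Set.range v))), 0 ≤ RCLike.re ⟪u, T c u⟫_ℂ) ∧
      (∀ i (c : ↥S), r' i c = ((Real.sqrt C : ℝ) : ℂ) • T c (∑ a, mellin (f i a) (-((c : ℝ) : ℂ)) • (⟨v a, Submodule.subset_span ⟨a, rfl⟩⟩ : ↥(Submodule.span ℂ (Set.range v))))) ∧
      (∀ i j, ⟪r' i, r' j⟫_ℂ = (C : ℂ) * ∑ c ∈ S, ⟪∑ b, mellin (f i b) (-(c : ℂ)) • (⟨v b, Submodule.subset_span ⟨b, rfl⟩⟩ : ↥(Submodule.span ℂ (Set.range v))),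
        ρ c • ∑ a, mellin (f j a) (-(c : ℂ)) • (⟨v a, Submodule.subset_span ⟨a, rfl⟩⟩ : ↥(Submodule.span ℂ (Set.range v)))⟫_ℂ) ∧
      (∀ i, (w i : ℝ → ↥(Submodule.span ℂ (Set.range v))) =ᵐ[(volume : Measure ℝ).restrict (Ioi 0)] fun t =>
        (∑ a, mellin (f i a) (-((((1 / 2 : ℝ)) : ℂ) + t * I)) • (⟨v a, Submodule.subset_span ⟨a, rfl⟩⟩ : ↥(Submodule.span ℂ (Set.range v)))) +
          qc default ((((1 / 2 : ℝ)) : ℂ) + ((-t : ℝ) : ℂ) * I) •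
            ∑ a, mellin (f i a) (-((((1 / 2 : ℝ)) : ℂ) + ((-t : ℝ) : ℂ) * I)) • (⟨v a, Submodule.subset_span ⟨a, rfl⟩⟩ : ↥(Submodule.span ℂ (Set.range v)))) ∧
      (∀ i, Uiso ⟨∑ a, y i a, mem_topologicalClosure_span (fun i => ∑ a, y i a) i⟩ = WithLp.toLp 2 (r' i, ((Real.sqrt (C * (2 * π)⁻¹) : ℝ) : ℂ) • w i)) := by
  classical
  have hφ0 : φ ≠ 0 := fun h => hφ1 (by rw [h, Pi.zero_apply])
  have h𝓕₀ : ν 𝓕 ≠ 0 := by rw [h𝓕1]; exact one_ne_zero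
  -- the sockets on THESE clauses: constant-term decay above every level (★ K2E1-p12) and the scalar functional equation (★ σ2)
  have hdec := hdec_maximalLevel_cm_two L ν h𝓕N h𝓕c hχ hφV hφc hφM hφinf
  have hFE : ∀ z : ℂ, z ∉ P → 1 - z ∉ P → qc default z * qc default (1 - z) = 1 :=
    chi_scattering_fe_m1_cm_two L μ νG ν h𝓕N h𝓕c h𝓕₀ hβ hμZ hsd hφV hφc hφM hφinf hφ0 hqφ hqcq hPc hPcd hPre hqa
  -- the entry letter `hs` and the finset `S` of genuine real poles (★ LetterFree §1)
  have hbill := chi_scattering_hs_of_scalarPackage_m1_cm_two L μ νG μK νI h𝓕I ν h𝓕N h𝓕1 h𝓕c hβ hχ hρ hsd hφV hφc hφM hφ1 hφ1r hqφ hqNF hE1 hqcq hPc hPcd hPre hqa U hUo hUcod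
    T₀ hT₀ Fam hFd hFam hs_tube hdec hFE hσ₀
  -- (conj) for the scalar on the tube formula (★ p860445), all indices `j : Unit`
  have hφK : ∀ k : (quasiSplit (↥(maximalRealSubfield L)) L (IsCMField.complexConj L) 2).Adelic,
      adelicVal (↥(maximalRealSubfield L)) L (IsCMField.complexConj L) 2 ((StdForm.antidiagonal 2).over L) k ∈ standardMaximalCompactGL 2 L → ∀ g, φ (g * k) = φ g :=
    fun k hk g => by simpa only [one_mul] using apply_mul_of_mem hφV g ⟨k, hk⟩
  have hconj' : ∀ j (z : ℂ), z ∉ P → conj z ∉ P → qc j (conj z) = conj (qc j z) := by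
    intro j
    obtain rfl : j = default := Subsingleton.elim _ _
    obtain ⟨cG, hcG⟩ := exists_galTwist_cm L
    exact chi_scattering_conj_symm_m1_cm_two L hcG ν ((ν 𝓕).toReal⁻¹) hsd hχ (isChiSection_of_mem hφV) hφK hφ1r hφ1r hPc hPcd hPre (hqa default) hs_tube
  -- the `L²(K_max)`-class of `φ|_{K_max}`: non-zero, a one-element linearly independent family
  haveI : CompactSpace ↥((standardMaximalCompactGL 2 L).comap (adelicVal (↥(maximalRealSubfield L)) L (IsCMField.complexConj L) 2 ((StdForm.antidiagonal 2).over L)) : Subgroup (quasiSplit (↥(maximalRealSubfield L)) L (IsCMField.complexConj L) 2).Adelic) :=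
    isCompact_iff_compactSpace.1 isCompact_comap_adelicVal_standardMaximalCompactGL
  haveI : IsFiniteMeasure μK := CompactSpace.isFiniteMeasure
  have hφKm : MemLp (fun k : ↥((standardMaximalCompactGL 2 L).comap (adelicVal (↥(maximalRealSubfield L)) L (IsCMField.complexConj L) 2 ((StdForm.antidiagonal 2).over L)) : Subgroup (quasiSplit (↥(maximalRealSubfield L)) L (IsCMField.complexConj L) 2).Adelic) => φ (k : (quasiSplit (↥(maximalRealSubfield L)) L (IsCMField.complexConj L) 2).Adelic)) 2 μK :=
    MemLp.of_bound (hφc.comp continuous_subtype_val).aestronglyMeasurable Mφ (Eventually.of_forall fun k => hφM _)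
  have hφKae : (((hφKm.toLp _ : Lp ℂ 2 μK)) : _ → ℂ) =ᵐ[μK] fun k => φ (k : (quasiSplit (↥(maximalRealSubfield L)) L (IsCMField.complexConj L) 2).Adelic) := MemLp.coeFn_toLp _
  have hφK0 : (hφKm.toLp _ : Lp ℂ 2 μK) ≠ 0 := ne_zero_of_coeFn_ae_eq L μK hφV hφ0 _ hφKae
  have hbKli : LinearIndependent ℂ (fun _ : Unit => (hφKm.toLp _ : Lp ℂ 2 μK)) := linearIndependent_unique_iff.2 hφK0
  have hκ := idelicBracket_pos νI h𝓕I
  -- the residues at every real `c > ½` (★ p860849), rescaled to the scalar (§1)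
  have hres : ∀ c : ℝ, 1 / 2 < c → ∃ ρc : ℂ, Tendsto (fun z : ℂ => (z - c) * qc default z) (𝓝[≠] (c : ℂ)) (𝓝 ρc) ∧ ρc.im = 0 ∧ 0 ≤ ρc.re := by
    intro c hc
    obtain ⟨-, u, r, cμ, K, -, -, -, hr, him, hre, -⟩ := chi_maassSelberg_residue_m1_cm_two L μ νG μK νI h𝓕I ν h𝓕N h𝓕1 h𝓕c hβ hχ hρ hsd hφc (isChiSection_of_mem hφV) hφM
      (fun _ : Unit => φ) hqφ hqNF hE1 hqcq hPc hPcd hqa (hφKm.toLp _) hφKae hφK0 (fun _ : Unit => (hφKm.toLp _ : Lp ℂ 2 μK)) (fun _ => hφKae) hbKli hκ U hUo hUcod T₀ hT₀ Fam hFd hFam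
      (fun n z' hz' => hdec (T₀ n) (hT₀ n) z' hz') hconj' (fun _ => rfl) hc
    exact ⟨_, tendsto_sub_mul_of_rankOne_pairing (φK := (hφKm.toLp _ : Lp ℂ 2 μK)) (qc := qc) (c := (c : ℂ)) hφK0 hκ hr,
      div_real_im_re him hre (mul_pos hκ (pow_pos (norm_pos_iff.2 hφK0) 2))⟩
  choose! ρ hρt hρim hρre using hres
  have hφχ : IsChiSection χ φ := isChiSection_of_mem hφV
  -- the letters of ★ `hSD_m1_cm_two` for the sections `c_a•φ`
  have haχ : ∀ a, IsChiSection χ (c a • φ) := fun a => hφχ.smul (c a)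
  have hac : ∀ a, Continuous (c a • φ) := fun a => hφc.const_smul (c a)
  have haC : ∀ a, ∃ Cφ : ℝ, ∀ x, ‖(c a • φ) x‖ ≤ Cφ := fun a => ⟨‖c a‖ * Mφ, fun x => by
    rw [Pi.smul_apply, norm_smul]; exact mul_le_mul_of_nonneg_left (hφM x) (norm_nonneg _)⟩
  have haK : ∀ a, ∀ k : (quasiSplit (↥(maximalRealSubfield L)) L (IsCMField.complexConj L) 2).Adelic,
      adelicVal (↥(maximalRealSubfield L)) L (IsCMField.complexConj L) 2 ((StdForm.antidiagonal 2).over L) k ∈ standardMaximalCompactGL 2 L → ∀ g : (quasiSplit (↥(maximalRealSubfield L)) L (IsCMField.complexConj L) 2).Adelic,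
        (c a • φ) (g * k) = (c a • φ) g := fun a k hk g => by rw [Pi.smul_apply, Pi.smul_apply, hφK k hk g]
  have ha1 : ∀ a, (c a • φ) 1 ≠ 0 := fun a => by rw [Pi.smul_apply, smul_eq_mul]; exact mul_ne_zero (hc a) hφ1
  have has : ∀ a, ∀ z : ℂ, 1 < z.re → qc default z = (((((ν 𝓕).toReal⁻¹ : ℝ))) : ℂ) * (((c a • φ) 1)⁻¹ * ∫ u : ↥(adelicUnipotent (↥(maximalRealSubfield L)) L (IsCMField.complexConj L) 2), flatSectionU (c a • φ) z
      (((quasiSplit (↥(maximalRealSubfield L)) L (IsCMField.complexConj L) 2).toAdelic (weylLongU ((IsCMField.complexConj L : L ≃ₐ[↥(maximalRealSubfield L)] L) : L →+* L) (rfl : (StdForm.antidiagonal 2).over L = (StdForm.antidiagonal 2).over L))) * ((u : (quasiSplit (↥(maximalRealSubfield L)) L (IsCMField.complexConj L) 2).Adelic) * 1)) ∂ν) :=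
    fun a z hz => by rw [tube_formula_smul L ν (hc a), hs_tube z hz]
  have hconjT : ∀ z : ℂ, 1 < z.re → qc default (conj z) = conj (qc default z) := by
    intro z hz
    refine hconj' default z (fun hP => ?_) (fun hP => ?_)
    · have := hPre z hP; linarith
    · have := hPre _ hP; rw [Complex.conj_re] at this; linarith
  -- axis continuity from (FE) + (conj) (★ p860080)
  have hcont : Continuous fun t : ℝ => qc default ((((1 / 2 : ℝ)) : ℂ) + t * I) := continuous_axis_of_fe_of_conj (hqNF default) hPcd hFE (hconj' default)
  -- `hB` (★ p861074) and `hSD` (★ p860947) on the clauses, then §1 at `V := W`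
  have hBex := hB_of_package_m1_cm_two L μ νG μK νI h𝓕I ν h𝓕N h𝓕1 h𝓕c hβ hμZ hχ hρ hsd hφV hφc hφM hφinf hφ1 hφ1r hqφ hqNF hE1 hqcq hPc hPcd hPre hqa U hUo hUcod T₀ hT₀ Fam hFd hFam
    hs_tube hσ₀
  have hSDex := hSD_m1_cm_two L μ νG μK νI h𝓕I ν h𝓕N h𝓕c h𝓕₀
  refine hbill.2.elim fun S hSU => hSU.elim fun U' hU' => ?_
  have hS := hU'.1
  refine hBex.elim fun B hB => hSDex.elim fun C hC => ?_
  have hSD := hC.2 (φ := fun a => c a • φ) (s := qc default) v y hχ hsd haχ hac haC haK ha1 has hconjT hf hfs hf0 hσ₀ hv hy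
  haveI : FiniteDimensional ℂ ↥(Submodule.span ℂ (Set.range v)) := finiteDimensional_span_range v
  refine (exists_linearIsometry_selfDual_of_scalar_letters_sqrt y hf hfs hf0 (fun a => (⟨v a, Submodule.subset_span ⟨a, rfl⟩⟩ : ↥(Submodule.span ℂ (Set.range v)))) (qc default) (show (1 / 2 : ℝ) < σ₀ by linarith)
    hU'.2.1 hU'.2.2.1 S (fun c hc => ⟨(hS c hc).2.1, (hS c hc).2.2⟩) hU'.2.2.2 ρ (fun c hc => hρt c (hS c hc).2.1) (fun c hc => hρim c (hS c hc).2.1)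
    (fun c hc => hρre c (hS c hc).2.1) hB hPcd hFE (hconj' default) hcont hC.1.le hSD).elim
    fun T h => h.elim fun r' h => h.elim fun w h => h.elim fun Uiso h => ?_
  exact ⟨C, S, ρ, T, r', w, Uiso, hC.1, hS, fun c hc => ⟨hρt c (hS c hc).2.1, hρim c (hS c hc).2.1, hρre c (hS c hc).2.1⟩, h.1, h.2.1, h.2.2.1, h.2.2.2.1, h.2.2.2.2.1,
    h.2.2.2.2.2.1, h.2.2.2.2.2.2⟩


/-! ## §3 HEAD: the letter-free print, square-root edition — structural binders only -/

/-- **HEAD — THE PLANCHEREL ISOMETRY OF THE RANK-ONE SELF-DUAL `χ`-BLOCK OF `U(1,1)_{L∕L⁺}` AT THE MAXIMAL LEVEL WITH THE EXPLICIT RESIDUE COORDINATE, LETTER-FREE** (= ★ p861211 §3 ∧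
the `T`-clauses).  Binders: structural data only (as ★ p861211 §3).  CONCLUSION: `∃ s P C S ρ T r′ w U` — ★ p861211's clauses (tube formula of `s`, normal form, `P` closed `⊆ {Re ≤ 1}`,
analyticity off `P`, `C > 0`, poles `S`, residues `ρ`, Gram, axis model, `U (Σ_a y_{i,a}) = (r′_i, √(C∕2π)•w_i)`) ∧ `T_c(T_c u) = ρ_c•u` ∧ `T_c` symmetric ∧ positive ∧
**`r′_i c = √C • T_c (Σ_a f̃_{i,a}(−c)•ṽ_a)`** — ★ `hU_selfDual_cm_two`'s model data at `vA a := ṽ_a`, `M z := s z • id`. [cite: MoeglinWaldspurger1995, II.2.4, IV.1.10–IV.1.11, IV.3.12]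
[cite: Langlands1976, §7] -/
theorem exists_linearIsometry_chiSection_selfDual_m1_letterFree_sqrt_cm_two
    (μ : Measure (quasiSplit (↥(maximalRealSubfield L)) L (IsCMField.complexConj L) 2).automorphicQuotient) [(quasiSplit (↥(maximalRealSubfield L)) L (IsCMField.complexConj L) 2).IsAutomorphicMeasure μ]
    (νG : Measure (quasiSplit (↥(maximalRealSubfield L)) L (IsCMField.complexConj L) 2).Adelic) [νG.IsHaarMeasure] [νG.IsInvInvariant] [SFinite νG]
    (μK : Measure ↥((standardMaximalCompactGL 2 L).comap (adelicVal (↥(maximalRealSubfield L)) L (IsCMField.complexConj L) 2 ((StdForm.antidiagonal 2).over L)) : Subgroup (quasiSplit (↥(maximalRealSubfield L)) L (IsCMField.complexConj L) 2).Adelic)) [μK.IsHaarMeasure]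
    (νI : Measure (AdeleRing (𝓞 L) L)ˣ) [νI.IsHaarMeasure]
    {𝓕I : Set (AdeleRing (𝓞 L) L)ˣ} (h𝓕I : IsIdeleClassDomain L 𝓕I)
    (ν : Measure ↥(adelicUnipotent (↥(maximalRealSubfield L)) L (IsCMField.complexConj L) 2)) [ν.IsHaarMeasure] [ν.IsMulRightInvariant] [ν.IsInvInvariant]
    {𝓕 : Set ↥(adelicUnipotent (↥(maximalRealSubfield L)) L (IsCMField.complexConj L) 2)} (h𝓕N : IsFundamentalDomain ↥(rationalUnipotent (↥(maximalRealSubfield L)) L (IsCMField.complexConj L) 2) 𝓕 ν) (h𝓕1 : ν 𝓕 = 1)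
    (h𝓕c : IsCompact (closure 𝓕))
    {β : (quasiSplit (↥(maximalRealSubfield L)) L (IsCMField.complexConj L) 2).Adelic → ℝ≥0∞} (hβ : IsCoveringWeight ↥((arithmeticBorel (↥(maximalRealSubfield L)) L (IsCMField.complexConj L) 2).map (quasiSplit (↥(maximalRealSubfield L)) L (IsCMField.complexConj L) 2).arithmeticSubgroup.subtype) β)
    {μZ : Measure (borelQuotient (↥(maximalRealSubfield L)) L (IsCMField.complexConj L) 2)} [SFinite μZ]
    (hμZ : ∀ f : borelQuotient (↥(maximalRealSubfield L)) L (IsCMField.complexConj L) 2 → ℝ≥0∞, Measurable f → ∫⁻ z, f z ∂μZ = ∫⁻ g, β g * f (toBorelQuotient (↥(maximalRealSubfield L)) L (IsCMField.complexConj L) 2 g) ∂νG)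
    {χ : HeckeCharacter L} (hχ : χ.IsUnitary) (hρ : ∀ r : ℝ≥0ˣ, χ (posRealIdele L r) = 1) (hsd : reflectChar (IsCMField.complexConj L) χ = χ)
    {φ : (quasiSplit (↥(maximalRealSubfield L)) L (IsCMField.complexConj L) 2).Adelic → ℂ} (hφV : φ ∈ chiSectionSpace χ ((standardMaximalCompactGL 2 L).comap (adelicVal (↥(maximalRealSubfield L)) L (IsCMField.complexConj L) 2 ((StdForm.antidiagonal 2).over L)) : Subgroup (quasiSplit (↥(maximalRealSubfield L)) L (IsCMField.complexConj L) 2).Adelic) (fun _ => 1)) (hφc : Continuous φ) {Mφ : ℝ} (hφM : ∀ x, ‖φ x‖ ≤ Mφ)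
    (hφinf : ∀ a : arch (↥(maximalRealSubfield L)) L (IsCMField.complexConj L) 2 ((StdForm.antidiagonal 2).over L), φ (archToAdelic (↥(maximalRealSubfield L)) L (IsCMField.complexConj L) 2 _ a) = φ 1)
    (hφ1 : φ 1 ≠ 0) (hφ1r : conj (φ 1) = φ 1)
    {ι α : Type*} [Fintype α] (c : α → ℂ) (hc : ∀ a, c a ≠ 0)
    (v : α → Lp ℂ 2 μK) (hv : ∀ a, ((v a : Lp ℂ 2 μK) : ↥((standardMaximalCompactGL 2 L).comap (adelicVal (↥(maximalRealSubfield L)) L (IsCMField.complexConj L) 2 ((StdForm.antidiagonal 2).over L)) : Subgroup (quasiSplit (↥(maximalRealSubfield L)) L (IsCMField.complexConj L) 2).Adelic) → ℂ) =ᵐ[μK]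
      fun k => (c a • φ) (k : (quasiSplit (↥(maximalRealSubfield L)) L (IsCMField.complexConj L) 2).Adelic))
    {f : ι → α → ℝ → ℂ} (hf : ∀ i a, ContDiff ℝ 2 (f i a)) (hfs : ∀ i a, HasCompactSupport (f i a)) (hf0 : ∀ i a, tsupport (f i a) ⊆ Ioi 0)
    (y : ι → α → Lp ℂ 2 μ) (hy : ∀ i a, ((y i a : Lp ℂ 2 μ) : (quasiSplit (↥(maximalRealSubfield L)) L (IsCMField.complexConj L) 2).automorphicQuotient → ℂ) =ᵐ[μ]
      (quasiSplit (↥(maximalRealSubfield L)) L (IsCMField.complexConj L) 2).quotFun (eisensteinSeriesU (fun g : (quasiSplit (↥(maximalRealSubfield L)) L (IsCMField.complexConj L) 2).Adelic => f i a (borelHeight g : ℝ) * (c a • φ) g)))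
    {σ₀ : ℝ} (hσ₀ : 1 < σ₀) :
    ∃ (s : ℂ → ℂ) (P : Set ℂ) (C : ℝ) (S : Finset ℝ) (ρ : ℝ → ℂ) (T : ↥S → ↥(Submodule.span ℂ (Set.range v)) →L[ℂ] ↥(Submodule.span ℂ (Set.range v))) (r' : ι → PiLp 2 (fun _ : ↥S => ↥(Submodule.span ℂ (Set.range v))))
      (w : ι → Lp ↥(Submodule.span ℂ (Set.range v)) 2 ((volume : Measure ℝ).restrict (Ioi 0)))
      (Uiso : (Submodule.span ℂ (Set.range fun i => ∑ a, y i a)).topologicalClosure →ₗᵢ[ℂ]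
        WithLp 2 (PiLp 2 (fun _ : ↥S => ↥(Submodule.span ℂ (Set.range v))) × Lp ↥(Submodule.span ℂ (Set.range v)) 2 ((volume : Measure ℝ).restrict (Ioi 0)))),
      (∀ z : ℂ, 1 < z.re → s z = (((ν 𝓕).toReal⁻¹ : ℝ) : ℂ) * ((φ 1)⁻¹ * ∫ u : ↥(adelicUnipotent (↥(maximalRealSubfield L)) L (IsCMField.complexConj L) 2), flatSectionU φ z
        ((quasiSplit (↥(maximalRealSubfield L)) L (IsCMField.complexConj L) 2).toAdelic (weylLongU (IsCMField.complexConj L : L →+* L)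
          (rfl : (StdForm.antidiagonal 2).over L = (StdForm.antidiagonal 2).over L)) * ((u : (quasiSplit (↥(maximalRealSubfield L)) L (IsCMField.complexConj L) 2).Adelic) * 1)) ∂ν)) ∧
      MeromorphicNFOn s univ ∧ IsClosed P ∧ (∀ z ∈ P, z.re ≤ 1) ∧ (∀ z : ℂ, z ∉ P → AnalyticAt ℂ s z) ∧
      0 < C ∧
      (∀ c ∈ S, ¬ AnalyticAt ℂ s (c : ℂ) ∧ 1 / 2 < c ∧ c < σ₀) ∧
      (∀ c ∈ S, Tendsto (fun z : ℂ => (z - c) * s z) (𝓝[≠] (c : ℂ)) (𝓝 (ρ c)) ∧ (ρ c).im = 0 ∧ 0 ≤ (ρ c).re) ∧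
      (∀ (c : ↥S) (u : ↥(Submodule.span ℂ (Set.range v))), T c (T c u) = ρ (c : ℝ) • u) ∧ (∀ (c : ↥S) (u u' : ↥(Submodule.span ℂ (Set.range v))), ⟪u, T c u'⟫_ℂ = ⟪T c u, u'⟫_ℂ) ∧
      (∀ (c : ↥S) (u : ↥(Submodule.span ℂ (Set.range v))), 0 ≤ RCLike.re ⟪u, T c u⟫_ℂ) ∧
      (∀ i (c : ↥S), r' i c = ((Real.sqrt C : ℝ) : ℂ) • T c (∑ a, mellin (f i a) (-((c : ℝ) : ℂ)) • (⟨v a, Submodule.subset_span ⟨a, rfl⟩⟩ : ↥(Submodule.span ℂ (Set.range v))))) ∧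
      (∀ i j, ⟪r' i, r' j⟫_ℂ = (C : ℂ) * ∑ c ∈ S, ⟪∑ b, mellin (f i b) (-(c : ℂ)) • (⟨v b, Submodule.subset_span ⟨b, rfl⟩⟩ : ↥(Submodule.span ℂ (Set.range v))),
        ρ c • ∑ a, mellin (f j a) (-(c : ℂ)) • (⟨v a, Submodule.subset_span ⟨a, rfl⟩⟩ : ↥(Submodule.span ℂ (Set.range v)))⟫_ℂ) ∧
      (∀ i, (w i : ℝ → ↥(Submodule.span ℂ (Set.range v))) =ᵐ[(volume : Measure ℝ).restrict (Ioi 0)] fun t =>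
        (∑ a, mellin (f i a) (-((((1 / 2 : ℝ)) : ℂ) + t * I)) • (⟨v a, Submodule.subset_span ⟨a, rfl⟩⟩ : ↥(Submodule.span ℂ (Set.range v)))) +
          s ((((1 / 2 : ℝ)) : ℂ) + ((-t : ℝ) : ℂ) * I) •
            ∑ a, mellin (f i a) (-((((1 / 2 : ℝ)) : ℂ) + ((-t : ℝ) : ℂ) * I)) • (⟨v a, Submodule.subset_span ⟨a, rfl⟩⟩ : ↥(Submodule.span ℂ (Set.range v)))) ∧
      (∀ i, Uiso ⟨∑ a, y i a, mem_topologicalClosure_span (fun i => ∑ a, y i a) i⟩ = WithLp.toLp 2 (r' i, ((Real.sqrt (C * (2 * π)⁻¹) : ℝ) : ℂ) • w i)) := by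
  classical
  -- ONE `obtain` of the package (★ `chi_scattering_real_poles_m1_complete_cm_two`), by `Exists.elim` and projections (the goal is large)
  have hpk := chi_scattering_real_poles_m1_complete_cm_two L μ νG μK νI h𝓕I ν h𝓕N h𝓕1 h𝓕c hβ hμZ hχ hρ hsd hφV hφc hφM hφinf hφ1 hφ1r
  refine hpk.elim fun bV h => h.elim fun q h => h.elim fun Ec h => h.elim fun qc h => h.elim fun P h => ?_
  have hbV := h.1
  have hcl := h.2.1
  have hs_tube := h.2.2.1
  have hqφ : ∀ z : ℂ, 1 < z.re → (∑ j, q j z • φ) = ((((ν 𝓕).toReal⁻¹ : ℝ)) : ℂ) • (fun g : (quasiSplit (↥(maximalRealSubfield L)) L (IsCMField.complexConj L) 2).Adelic => (∫ v : ↥(adelicUnipotent (↥(maximalRealSubfield L)) L (IsCMField.complexConj L) 2), flatSectionU φ z ((quasiSplit (↥(maximalRealSubfield L)) L (IsCMField.complexConj L) 2).toAdelic (weylLongU ((IsCMField.complexConj L : L ≃ₐ[↥(maximalRealSubfield L)] L) : L →+* L) (rfl : (StdForm.antidiagonal 2).over L = (StdForm.antidiagonal 2).over L)) * ((v : (quasiSplit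 (↥(maximalRealSubfield L)) L (IsCMField.complexConj L) 2).Adelic) * g)) ∂ν) * (((borelHeight g : ℝ) : ℂ) ^ (z - 1))) := fun z hz => by
    rw [← hcl.2.1 z hz]
    exact Finset.sum_congr rfl fun j _ => by rw [hbV j]
  have hqNF := hcl.2.2.2.1
  have hE1 := hcl.2.2.2.2.1
  have hqcq := hcl.2.2.2.2.2.1
  have hPc := hcl.2.2.2.2.2.2.1
  have hPcd := hcl.2.2.2.2.2.2.2.1
  have hPre := hcl.2.2.2.2.2.2.2.2.1
  have hqa := hcl.2.2.2.2.2.2.2.2.2.2.1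
  have hF := hcl.2.2.2.2.2.2.2.2.2.2.2.2.2.2
  -- skolemise the per-ball families
  choose U hU using hF
  choose T₀ hT using fun n => (hU n).2.2.2
  choose Fam hFam using fun n => (hT n).2
  refine (exists_linearIsometry_chiSection_selfDual_m1_rankOne_sqrt_of_package L μ νG μK νI h𝓕I ν h𝓕N h𝓕1 h𝓕c hβ hμZ hχ hρ hsd hφV hφc hφM hφinf hφ1 hφ1r hqφ hqNF hE1 hqcq hPc hPcd
    hPre hqa U (fun n => (hU n).1) (fun n => (hU n).2.2.1) T₀ (fun n => (hT n).1) Fam (fun n => (hFam n).1) (fun n => (hFam n).2) hs_tube c hc v hv hf hfs hf0 y hy hσ₀).elim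
    fun C h => h.elim fun S h => h.elim fun ρ h => h.elim fun T h => h.elim fun r' h => h.elim fun w h => h.elim fun Uiso h => ?_
  exact ⟨qc default, P, C, S, ρ, T, r', w, Uiso, hs_tube, hqNF default, hPc, hPre, hqa default, h.1, h.2.1, h.2.2.1, h.2.2.2.1, h.2.2.2.2.1, h.2.2.2.2.2.1,
    h.2.2.2.2.2.2.1, h.2.2.2.2.2.2.2.1, h.2.2.2.2.2.2.2.2.1, h.2.2.2.2.2.2.2.2.2⟩


end CM

end Summit.HodgeConjecture.HodgeConjecture.Cruxes.H413.K2E1ChiSectionPlancherelSelfDualM1CMTwoSqrt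

end
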